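import Summits.Ventures.HodgeRepro2.T7SupportOneVectorOrbital

/-!
# The one-vector orbital integral is bounded by the supremum of the coefficient (support, seat p1)

For the ONE-vector test function `f(g) = ⟪v, τ(g) v⟫` of a unitary representation `τ` (the line's `f_v`,
L3-ARGUMENT §2g), the second-torus integral of `T7SupportOneVectorOrbital` is the `q`-th Fourier coefficient
`Φ_q(γ) = ∫_K conj(w^q) ⟪v, τ(γ h ρ_B(w) h⁻¹) v⟫ dw` of a function on the circle, integrated against the
PROBABILITY Haar measure; hence

  `‖Φ_q(γ)‖ ≤ sup_w ‖⟪v, τ(γ h ρ_B(w) h⁻¹) v⟫‖`   (`norm_fourierCoeff_le_of_forall`: any uniform bound `C`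
  on the coefficient along the second-torus orbit bounds the Fourier coefficient),

and in particular `‖Φ_q(γ)‖ ≤ ‖v‖²` (`norm_fourierCoeff_le`: `‖⟪v, τ(g) v⟫‖ ≤ ‖v‖ ‖τ(g) v‖ = ‖v‖²` by
Cauchy–Schwarz and unitarity, `norm_coeff_le`). The full two-torus orbital integral inherits both bounds
(`norm_torus_orbital_one_vector_le`, `norm_torus_orbital_one_vector_le_of_forall`): the «`a_bound` for the
one-vector `f` at `γ ≠ 1`» of crit-1 (r3) reduces to a bound on the coefficient along the compact second-torus
orbit — in the explicit model, a `κ(γ)^{−k/2}`-decay (`T7SupportBergmanOneVectorDecay`).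

Nothing here is about any specific group, the adelic group, or any period.
Blind lane: Mathlib + the HodgeRepro2 prefix only; no sorry; axioms ⊆ {propext, Classical.choice, Quot.sound}.
-/

namespace Summit.Ventures.HodgeRepro2.T7SupportOneVectorBound

open MeasureTheory
open scoped InnerProductSpace
open T5HaarCircle T7SupportWeightTorusOrbital T7SupportOneVectorOrbital

variable {G : Type*} [Group G] {V : Type*} [NormedAddCommGroup V] [InnerProductSpace ℂ V]

/-- a unitary representation preserves norms -/
theorem norm_apply_eq {τ : G →* (V →ₗ[ℂ] V)} (hτ : IsUnitaryRep τ) (g : G) (v : V) : ‖τ g v‖ = ‖v‖ := by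
  have h := hτ g v v
  rw [← sq_eq_sq₀ (norm_nonneg _) (norm_nonneg _), ← inner_self_eq_norm_sq (𝕜 := ℂ),
    ← inner_self_eq_norm_sq (𝕜 := ℂ), h]

/-- **the one-vector coefficient is bounded by `‖v‖²`** (Cauchy–Schwarz + unitarity) -/
theorem norm_coeff_le {τ : G →* (V →ₗ[ℂ] V)} (hτ : IsUnitaryRep τ) (v : V) (g : G) :
    ‖coeff τ v v g‖ ≤ ‖v‖ ^ 2 := by
  unfold coeff
  calc ‖⟪v, τ g v⟫_ℂ‖ ≤ ‖v‖ * ‖τ g v‖ := norm_inner_le_norm v (τ g v)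
    _ = ‖v‖ ^ 2 := by rw [norm_apply_eq hτ, sq]

variable [MeasurableSpace Circle] [BorelSpace Circle]

/-- **the Fourier coefficient is bounded by any uniform bound of the coefficient along the second-torus
orbit** (the circle carries the probability Haar measure) -/
theorem norm_fourierCoeff_le_of_forall (τ : G →* (V →ₗ[ℂ] V)) (v : V) (h : G) (ρB : Circle →* G) (q : ℤ)
    (γ : G) {C : ℝ} (hC : ∀ w : Circle, ‖coeff τ v v (γ * (h * ρB w * h⁻¹))‖ ≤ C) :
    ‖T7SupportOneVectorOrbital.fourierCoeff τ v h ρB q γ‖ ≤ C := by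
  unfold T7SupportOneVectorOrbital.fourierCoeff
  have hb : ∀ w : Circle,
      ‖(starRingEnd ℂ) ((w : ℂ) ^ q) * coeff τ v v (γ * (h * ρB w * h⁻¹))‖ ≤ C := by
    intro w
    rw [norm_mul, Complex.norm_conj, norm_zpow, Circle.norm_coe, one_zpow, one_mul]
    exact hC w
  calc ‖∫ w : Circle, (starRingEnd ℂ) ((w : ℂ) ^ q) * coeff τ v v (γ * (h * ρB w * h⁻¹)) ∂haarCircle‖
      ≤ C * (haarCircle : Measure Circle).real Set.univ :=
        norm_integral_le_of_norm_le_const (Filter.Eventually.of_forall hb)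
    _ = C := by rw [probReal_univ, mul_one]

/-- **`‖Φ_q(γ)‖ ≤ ‖v‖²`** -/
theorem norm_fourierCoeff_le {τ : G →* (V →ₗ[ℂ] V)} (hτ : IsUnitaryRep τ) (v : V) (h : G) (ρB : Circle →* G)
    (q : ℤ) (γ : G) : ‖T7SupportOneVectorOrbital.fourierCoeff τ v h ρB q γ‖ ≤ ‖v‖ ^ 2 :=
  norm_fourierCoeff_le_of_forall τ v h ρB q γ (fun _ => norm_coeff_le hτ v _)

/-- the two-torus orbital integral of the one-vector coefficient is bounded by the Fourier coefficient -/
theorem norm_torus_orbital_one_vector_le {τ : G →* (V →ₗ[ℂ] V)} (hτ : IsUnitaryRep τ) {ρA : Circle →* G}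
    {a : ℤ} {v : V} (hA : IsWeightVector τ ρA a v) (h : G) (ρB : Circle →* G) (γ : G) (p q : ℤ) :
    ‖∫ u : Circle, ∫ w : Circle,
        coeff τ v v (ρA u * γ * (h * ρB w * h⁻¹)) * ((u : ℂ) ^ p * (starRingEnd ℂ) ((w : ℂ) ^ q))
        ∂haarCircle ∂haarCircle‖ ≤ ‖T7SupportOneVectorOrbital.fourierCoeff τ v h ρB q γ‖ := by
  rw [torus_orbital_one_vector_eq hτ hA h ρB γ p q, norm_mul]
  have h1 : ‖(if a + p = 0 then (1 : ℂ) else 0)‖ ≤ 1 := by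
    split_ifs <;> simp
  calc ‖(if a + p = 0 then (1 : ℂ) else 0)‖ * ‖T7SupportOneVectorOrbital.fourierCoeff τ v h ρB q γ‖
      ≤ 1 * ‖T7SupportOneVectorOrbital.fourierCoeff τ v h ρB q γ‖ := by gcongr
    _ = ‖T7SupportOneVectorOrbital.fourierCoeff τ v h ρB q γ‖ := one_mul _

/-- **the two-torus orbital integral of the one-vector coefficient is bounded by any uniform bound of the
coefficient along the second-torus orbit of `γ`** -/
theorem norm_torus_orbital_one_vector_le_of_forall {τ : G →* (V →ₗ[ℂ] V)} (hτ : IsUnitaryRep τ)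
    {ρA : Circle →* G} {a : ℤ} {v : V} (hA : IsWeightVector τ ρA a v) (h : G) (ρB : Circle →* G) (γ : G)
    (p q : ℤ) {C : ℝ} (hC : ∀ w : Circle, ‖coeff τ v v (γ * (h * ρB w * h⁻¹))‖ ≤ C) :
    ‖∫ u : Circle, ∫ w : Circle,
        coeff τ v v (ρA u * γ * (h * ρB w * h⁻¹)) * ((u : ℂ) ^ p * (starRingEnd ℂ) ((w : ℂ) ^ q))
        ∂haarCircle ∂haarCircle‖ ≤ C :=
  (norm_torus_orbital_one_vector_le hτ hA h ρB γ p q).trans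
    (norm_fourierCoeff_le_of_forall τ v h ρB q γ hC)

/-- the trivial bound `‖v‖²` on the two-torus orbital integral of the one-vector coefficient -/
theorem norm_torus_orbital_one_vector_le_sq {τ : G →* (V →ₗ[ℂ] V)} (hτ : IsUnitaryRep τ)
    {ρA : Circle →* G} {a : ℤ} {v : V} (hA : IsWeightVector τ ρA a v) (h : G) (ρB : Circle →* G) (γ : G)
    (p q : ℤ) :
    ‖∫ u : Circle, ∫ w : Circle,
        coeff τ v v (ρA u * γ * (h * ρB w * h⁻¹)) * ((u : ℂ) ^ p * (starRingEnd ℂ) ((w : ℂ) ^ q))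
        ∂haarCircle ∂haarCircle‖ ≤ ‖v‖ ^ 2 :=
  norm_torus_orbital_one_vector_le_of_forall hτ hA h ρB γ p q (fun _ => norm_coeff_le hτ v _)

end Summit.Ventures.HodgeRepro2.T7SupportOneVectorBound
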